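import Summits.KontsevichZagierPeriods.Zeta5Search.Barrier.ConeGammaLogCuspUniform
import Summits.KontsevichZagierPeriods.Zeta5Search.Barrier.ConeGammaCuspPeriodModulus

/-!
# ζ(5) search — BARRIER: THE MODULUS DECIDES LOCAL MAXIMALITY — `Λ < 0 ⇒` strict cusp-type local maximum of `Φ` on the slice, `Λ > 0 ⇒` not

HONEST FRAMING (cell `pub-zeta5`): systematic search; no irrationality claim unless kernel-certified. MODEL objects
under Brown–Zudilin's (28)+(30) accounting ([BZ22] = arXiv:2210.03391; (28) observed, not proved); nothing here is a
statement about `ζ(5)`, any `γ` of record, the cone's supremum (C2 OPEN) or the value / sign of the cusp slope or of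
the modulus at a named direction — at the four named directions of the cell ascent rays are known (DATA), so NO named
direction is asserted to be a local maximum of anything; the lemma S-E stays CONJECTURED, and every ball below is Lemma
B's coherence ball, not S-E's covering ball; records in print UNMOVED. Prover P2 g37,
file (2) of three of the item «THE LOG-CUSP EXPANSION IS UNIFORM; Λ IS ITS SHARP COEFFICIENT» (P2 g36's successor menu (a)).

THE POINT. File (1b) (`ConeGammaLogCuspUniform`) put the log-cusp expansion on a whole `Y`-ball with ONE constant:
`Φ(s(a)+η) − Φ(s(a)) = (σ(η)/T)·log(1/Y(η)) + O(Y(η))`. P2 g36's global ascent modulus `Λ(a,T)` (`exists_modulus_ray`: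
`σ(η) ≤ Λ·spread(η)` for every `η`, sharp) is therefore THE first-order datum of the MODEL saving near a rational
direction. With the rate SPREAD `r_M(η) − r_m(η)` (`r_k = φ_k/h_k(a)`; `m`, `M` any slowest / fastest pair) and the
SLICE `{η₀ = 0}` of displacements keeping `s₀` fixed (the coordinates `t = s/s₀` of `BARRIER-PLAN.md` §2b, in which
S-E′ is phrased; the slice kills the radial gauge `ℝ·s(a)`, along which `Φ` is linear, `phi30_smul`):
* **`phi30_sub_le_modulus_nhds`** — Λ CONTROLS THE SAVING TO FIRST ORDER, UNIFORMLY: for any `x` carrying the modulus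
  bound, `Φ(s(a)+η) − Φ(s(a)) ≤ (σ(x)/T)·spread(η)·log(1/Y(η)) + C·Y(η)` for EVERY `η` with `0 < Y(η) ≤ r` — either
  sign of `σ(x)`; at a strict cusp top (`Λ < 0`) this IS the shape of S-E′ («resonance dominance», negative `Y log(1/Y)`
  term) on the coherence ball, at `Λ > 0` it is the S-E upper-modulus shape there with `A = Λ/T`;
* (file (1b): on the slice the spread is a norm, `shiftSize_le_mul_spread_of_apply_zero` —
  `Y(η) ≤ (x_max + 3x_max²/(2s₀))·spread(η)` when `η₀ = 0`; here `eq_zero_of_apply_zero_of_forall_rate_eq`);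
* **`phi30_sub_le_neg_on_slice`**, **`phi30_lt_on_slice_of_modulus_neg`** — `Λ < 0 ⇒` on the slice
  `Φ(s(a)+η) − Φ(s(a)) ≤ −B·Y(η)·log(1/Y(η)) + C·Y(η)` with `B = |Λ|/(T·(x_max + 3x_max²/(2s₀))) > 0`, hence
  `Φ(s(a)+η) < Φ(s(a))` for all `η₀ = 0`, `0 < Y(η) ≤ r`: A STRICT CUSP TOP IS A STRICT, CUSP-TYPE LOCAL MAXIMUM OF
  THE MODEL SAVING on the slice `η₀ = 0`, inside the box (open box: unconditionally), on Lemma B's coherence ball;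
* **`exists_phi30_gt_on_slice_of_cuspSlope_pos`** — conversely ONE ascent direction (`σ(δ) > 0`, e.g. `Λ > 0`) gives,
  inside every `Y`-ball, a slice displacement with `Φ(s(a)+η) > Φ(s(a))`: NOT a local maximum on the slice `η₀ = 0`,
  inside the open box, on any ball;
* **`phi30_lt_on_slice_of_strict{,_canonical}`**, **`slice_dichotomy_openBox`** — packaged with P2 g36's modulus ray:
  STRICT CUSP TOP (`σ < 0` off the radial line, `⇔ Λ < 0`) `⇒` strict local maximum on the slice `η₀ = 0`, inside the
  (open) box, on Lemma B's coherence ball; an ascent direction (`⇔ Λ > 0`) `⇒` none; the flat case `Λ = 0` is NOT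
  decided by the first order, so no «iff» is claimed;
* **`isLocalMaxOn_slice_of_strict`**, **`not_isLocalMaxOn_slice_of_ascent`** — the same in Mathlib's topological
  vocabulary: `IsLocalMaxOn (η ↦ Φ(aOfS(s(a)+η))) {η | η₀ = 0} 0`, resp. its negation — on the slice `η₀ = 0`, inside
  the open box, from Lemma B's coherence ball; the flat case `Λ = 0` is NOT decided (two implications, no iff).
NOT here (honest): which lattice directions have `Λ < 0` (at record/41, flag/60, argmax-120, t*/480 ascent rays EXIST —
DATA of P2 g11/g34–g36 and relay 268 — so none of them is covered by the local-maximum half); the radius is file (1b)'s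
coherence radius — this ball is Lemma B's coherence ball, not S-E's covering ball of radius `1/(2λ₀)`, and S-E stays
CONJECTURED; nothing about `γ` (whose local behaviour would need the Lipschitz data of
`gamma_logCusp_of_lipschitz_cuspSlope`), C2 or `ζ(5)`.
-/

noncomputable section

open Set MeasureTheory Filter
open scoped Topology

namespace Summit.KontsevichZagierPeriods.Zeta5Search.Barrier.ConeGamma

/-! ### `Λ` controls the saving to first order, uniformly on the ball -/

/-- **Λ CONTROLS THE SAVING TO FIRST ORDER ON THE BALL.** All 28 forms of `a` positive, `a` in the closed box, `T > 0`
a period, and `x` ANY displacement carrying the modulus bound (`σ(δ) ≤ σ(x)·(r_M(δ) − r_m(δ))` for every `δ` and every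
slowest / fastest pair — (i) of P2 g36's `exists_modulus_ray`, `σ(x) = Λ(a,T)`). There are `C` and `r > 0` such that
for EVERY displacement `η` with `0 < Y(η) ≤ r`, `s(a)+η` in the closed box, and every slowest / fastest pair `(m, M)`
of its rates: `Φ(s(a)+η) − Φ(s(a)) ≤ σ(x)·(r_M(η) − r_m(η))/T · log(1/Y(η)) + C·Y(η)`. Either sign of `σ(x)`: for
`Λ < 0` a NEGATIVE `spread·log(1/Y)` term (S-E′'s shape on the coherence ball), for `Λ ≥ 0` an upper modulus with the
sharp constant `Λ/T`. No value of `Λ` at a named direction is asserted. -/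
theorem phi30_sub_le_modulus_nhds {a : Dir} (ha : BZBox a) (hpos : ∀ k, 0 < h28 a k) {T : ℝ} (hT : 0 < T)
    (hper : ∀ k : Fin 28, ∃ z : ℤ, T * h28 a k = z) {x : Fin 8 → ℝ}
    (hmod : ∀ δ : Fin 8 → ℝ, ∀ m M : Fin 28, (∀ k, phiForm δ m / h28 a m ≤ phiForm δ k / h28 a k ∧
        phiForm δ k / h28 a k ≤ phiForm δ M / h28 a M) →
      cuspSlope a T δ ≤ cuspSlope a T x * (phiForm δ M / h28 a M - phiForm δ m / h28 a m)) :
    ∃ C r : ℝ, 0 < r ∧ ∀ η : Fin 8 → ℝ, 0 < shiftSize η → shiftSize η ≤ r → BZBox (aOfS (sParam a + η)) →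
      ∀ m M : Fin 28, (∀ k, phiForm η m / h28 a m ≤ phiForm η k / h28 a k ∧
          phiForm η k / h28 a k ≤ phiForm η M / h28 a M) →
        phi30 (aOfS (sParam a + η)) - phi30 a
          ≤ cuspSlope a T x * (phiForm η M / h28 a M - phiForm η m / h28 a m) / T * Real.log (1 / shiftSize η)
            + C * shiftSize η := by
  obtain ⟨C, r, hr, h⟩ := phi30_logCusp_nhds ha hpos hT hper
  refine ⟨C, min r 1, lt_min hr one_pos, fun η hY hYr hbox m M hmM => ?_⟩
  have hmain := (abs_le.mp (h η hY (hYr.trans (min_le_left _ _)) hbox)).2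
  have hL : 0 ≤ Real.log (1 / shiftSize η) :=
    Real.log_nonneg ((one_le_div hY).mpr (hYr.trans (min_le_right _ _)))
  have hσ : cuspSlope a T η / T * Real.log (1 / shiftSize η)
      ≤ cuspSlope a T x * (phiForm η M / h28 a M - phiForm η m / h28 a m) / T * Real.log (1 / shiftSize η) :=
    mul_le_mul_of_nonneg_right (div_le_div_of_nonneg_right (hmod η m M hmM) hT.le) hL
  linarith

/-! ### The slice `{η₀ = 0}` -/

/-- A slice displacement with all rates equal is `0`. -/
theorem eq_zero_of_apply_zero_of_forall_rate_eq {a : Dir} (hpos : ∀ k, 0 < h28 a k) {η : Fin 8 → ℝ} (h0 : η 0 = 0)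
    {c : ℝ} (h : ∀ k, phiForm η k / h28 a k = c) : η = 0 := by
  have e := eq_smul_sParam_of_forall_rate_eq hpos h
  have h00 : c * sParam a 0 = 0 := by
    have := congrArg (fun f => f 0) e
    simp only [Pi.smul_apply, smul_eq_mul, h0] at this
    exact this.symm
  rcases mul_eq_zero.mp h00 with hc | hs
  · rw [e, hc, zero_smul]
  · exact absurd hs (sParam_zero_pos hpos).ne'

/-! ### `Λ < 0`: a strict cusp top is a strict, cusp-type local maximum on the slice `η₀ = 0` (inside the box, coherence ball) -/

/-- **`Λ < 0 ⇒` CUSP-TYPE DESCENT ON THE SLICE, UNIFORMLY.** All 28 forms of `a` positive, `a` in the closed box,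
`T > 0` a period, `x` carrying the modulus bound with `σ(x) < 0`. There are `C` and `r > 0` with
`Φ(s(a)+η) − Φ(s(a)) ≤ (σ(x)/(T·(x_max + 3x_max²/(2s₀))))·Y(η)·log(1/Y(η)) + C·Y(η)` for EVERY slice displacement
`η` (`η₀ = 0`) with `0 < Y(η) ≤ r` and `s(a)+η` in the closed box — the S-E′ shape `−B·Y·log(1/Y) + C·Y`, `B > 0`,
on the coherence ball. -/
theorem phi30_sub_le_neg_on_slice {a : Dir} (ha : BZBox a) (hpos : ∀ k, 0 < h28 a k) {T : ℝ} (hT : 0 < T)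
    (hper : ∀ k : Fin 28, ∃ z : ℤ, T * h28 a k = z) {x : Fin 8 → ℝ}
    (hmod : ∀ δ : Fin 8 → ℝ, ∀ m M : Fin 28, (∀ k, phiForm δ m / h28 a m ≤ phiForm δ k / h28 a k ∧
        phiForm δ k / h28 a k ≤ phiForm δ M / h28 a M) →
      cuspSlope a T δ ≤ cuspSlope a T x * (phiForm δ M / h28 a M - phiForm δ m / h28 a m))
    (hneg : cuspSlope a T x < 0) :
    ∃ C r : ℝ, 0 < r ∧ ∀ η : Fin 8 → ℝ, η 0 = 0 → 0 < shiftSize η → shiftSize η ≤ r →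
      BZBox (aOfS (sParam a + η)) →
        phi30 (aOfS (sParam a + η)) - phi30 a
          ≤ cuspSlope a T x / (T * (xMax a + 3 * xMax a ^ 2 / (2 * sParam a 0))) * shiftSize η
              * Real.log (1 / shiftSize η) + C * shiftSize η := by
  obtain ⟨C, r, hr, h⟩ := phi30_sub_le_modulus_nhds ha hpos hT hper hmod
  refine ⟨C, min r 1, lt_min hr one_pos, fun η h0 hY hYr hbox => ?_⟩
  obtain ⟨m, -, hm⟩ := Finset.exists_min_image Finset.univ (fun k => phiForm η k / h28 a k) Finset.univ_nonempty
  obtain ⟨M, -, hM⟩ := Finset.exists_max_image Finset.univ (fun k => phiForm η k / h28 a k) Finset.univ_nonempty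
  have hmM : ∀ k, phiForm η m / h28 a m ≤ phiForm η k / h28 a k ∧ phiForm η k / h28 a k ≤ phiForm η M / h28 a M :=
    fun k => ⟨hm k (Finset.mem_univ _), hM k (Finset.mem_univ _)⟩
  have hmain := h η hY (hYr.trans (min_le_left _ _)) hbox m M hmM
  have hL : 0 ≤ Real.log (1 / shiftSize η) :=
    Real.log_nonneg ((one_le_div hY).mpr (hYr.trans (min_le_right _ _)))
  have hκ : 0 < xMax a + 3 * xMax a ^ 2 / (2 * sParam a 0) := by
    have := xMax_pos hpos; have := sParam_zero_pos hpos; positivity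
  have hcmp := shiftSize_le_mul_spread_of_apply_zero hpos h0 hmM
  -- `σ(x) < 0` turns the lower bound on the spread into an upper bound on the cusp term
  have hstep : cuspSlope a T x * (phiForm η M / h28 a M - phiForm η m / h28 a m)
      ≤ cuspSlope a T x * (shiftSize η / (xMax a + 3 * xMax a ^ 2 / (2 * sParam a 0))) := by
    refine mul_le_mul_of_nonpos_left ?_ hneg.le
    rwa [div_le_iff₀' hκ]
  have hstep' := mul_le_mul_of_nonneg_right (div_le_div_of_nonneg_right hstep hT.le) hL
  have e : cuspSlope a T x * (shiftSize η / (xMax a + 3 * xMax a ^ 2 / (2 * sParam a 0))) / T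
      = cuspSlope a T x / (T * (xMax a + 3 * xMax a ^ 2 / (2 * sParam a 0))) * shiftSize η := by
    field_simp
  rw [e] at hstep'
  linarith

/-- **A STRICT CUSP TOP IS A STRICT LOCAL MAXIMUM OF THE MODEL SAVING on the slice `η₀ = 0`, inside the box, on Lemma B's
coherence ball** (modulus form). All 28 forms of `a` positive, `a` in the closed box, `T > 0` a period, `x` carrying
the modulus bound with `σ(x) < 0` (`Λ(a,T) < 0`). There is `r > 0` with `Φ(s(a)+η) < Φ(s(a))` for EVERY slice
displacement `η` (`η₀ = 0`) with `0 < Y(η) ≤ r` and `s(a)+η` in the closed box. (The negative `Y·log(1/Y)` term of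
`phi30_sub_le_neg_on_slice` beats `C·Y` once `log(1/Y) ≥ (|C|+1)/B`; `r` is at most Lemma B's coherence radius — this
ball is Lemma B's coherence ball, not S-E's covering ball; S-E stays CONJECTURED.) No named direction is asserted to
satisfy the hypothesis; the flat case `Λ = 0` is not decided. -/
theorem phi30_lt_on_slice_of_modulus_neg {a : Dir} (ha : BZBox a) (hpos : ∀ k, 0 < h28 a k) {T : ℝ} (hT : 0 < T)
    (hper : ∀ k : Fin 28, ∃ z : ℤ, T * h28 a k = z) {x : Fin 8 → ℝ}
    (hmod : ∀ δ : Fin 8 → ℝ, ∀ m M : Fin 28, (∀ k, phiForm δ m / h28 a m ≤ phiForm δ k / h28 a k ∧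
        phiForm δ k / h28 a k ≤ phiForm δ M / h28 a M) →
      cuspSlope a T δ ≤ cuspSlope a T x * (phiForm δ M / h28 a M - phiForm δ m / h28 a m))
    (hneg : cuspSlope a T x < 0) :
    ∃ r : ℝ, 0 < r ∧ ∀ η : Fin 8 → ℝ, η 0 = 0 → 0 < shiftSize η → shiftSize η ≤ r →
      BZBox (aOfS (sParam a + η)) → phi30 (aOfS (sParam a + η)) < phi30 a := by
  obtain ⟨C, r, hr, h⟩ := phi30_sub_le_neg_on_slice ha hpos hT hper hmod hneg
  -- the descent rate `B = −σ(x)/(T·κ) > 0` and the threshold `L₀ = (|C|+1)/B`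
  obtain ⟨B, hB⟩ : ∃ B : ℝ, B = -(cuspSlope a T x / (T * (xMax a + 3 * xMax a ^ 2 / (2 * sParam a 0)))) :=
    ⟨_, rfl⟩
  have hκ : 0 < xMax a + 3 * xMax a ^ 2 / (2 * sParam a 0) := by
    have := xMax_pos hpos; have := sParam_zero_pos hpos; positivity
  have hBpos : 0 < B := by rw [hB, neg_pos]; exact div_neg_of_neg_of_pos hneg (mul_pos hT hκ)
  obtain ⟨L₀, hL₀⟩ : ∃ L₀ : ℝ, L₀ = (|C| + 1) / B := ⟨_, rfl⟩
  refine ⟨min r (Real.exp (-L₀)), lt_min hr (Real.exp_pos _), fun η h0 hY hYr hbox => ?_⟩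
  have hmain := h η h0 hY (hYr.trans (min_le_left _ _)) hbox
  rw [show cuspSlope a T x / (T * (xMax a + 3 * xMax a ^ 2 / (2 * sParam a 0))) = -B by rw [hB, neg_neg]]
    at hmain
  -- `log(1/Y) ≥ L₀`
  have hL : L₀ ≤ Real.log (1 / shiftSize η) := by
    have h1 : Real.exp L₀ ≤ 1 / shiftSize η := by
      rw [le_div_iff₀ hY]
      calc Real.exp L₀ * shiftSize η ≤ Real.exp L₀ * Real.exp (-L₀) :=
            mul_le_mul_of_nonneg_left (hYr.trans (min_le_right _ _)) (Real.exp_pos _).le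
        _ = 1 := by rw [← Real.exp_add, add_neg_cancel, Real.exp_zero]
    have := Real.log_le_log (Real.exp_pos _) h1
    rwa [Real.log_exp] at this
  have hBL : |C| + 1 ≤ B * Real.log (1 / shiftSize η) := by
    have := mul_le_mul_of_nonneg_left hL hBpos.le
    rwa [hL₀, mul_div_cancel₀ _ hBpos.ne'] at this
  have hC := le_abs_self C
  nlinarith

/-! ### `Λ > 0`: an ascent direction excludes a local maximum on the slice `η₀ = 0` (open box) -/

/-- **ONE ASCENT DIRECTION EXCLUDES A LOCAL MAXIMUM on the slice `η₀ = 0`, inside the open box, on every ball** (so in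
particular on Lemma B's coherence ball). For `a` with `0 < s_j(a) < s₀(a)` (`j = 1..7`), a period `T`, and ANY
displacement `x` with `cuspSlope a T x > 0` (e.g. the modulus ray when `Λ > 0`): inside every `Y`-ball there is a
slice displacement `η` (`η₀ = 0`, `0 < Y(η) ≤ r`) with `Φ(s(a)+η) > Φ(s(a))`.
(Gauge `x` into the slice by `x − (x₀/s₀)•s(a)` — the slope is unchanged, `cuspSlope_add_smul_sParam` — and shrink it:
the positive `Y·log(1/Y)` term of file (1b)'s ball expansion beats `C·Y`.) -/
theorem exists_phi30_gt_on_slice_of_cuspSlope_pos {a : Dir}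
    (hopen : ∀ j : Fin 7, 0 < sParam a j.succ ∧ sParam a j.succ < sParam a 0)
    {T : ℝ} (hT : 0 < T) (hper : ∀ k : Fin 28, ∃ z : ℤ, T * h28 a k = z) {x : Fin 8 → ℝ}
    (hxpos : 0 < cuspSlope a T x) {r : ℝ} (hr : 0 < r) :
    ∃ η : Fin 8 → ℝ, η 0 = 0 ∧ 0 < shiftSize η ∧ shiftSize η ≤ r ∧ phi30 a < phi30 (aOfS (sParam a + η)) := by
  have hpos := h28_pos_of_openBox hopen
  have hs0 := sParam_zero_pos hpos
  obtain ⟨C, r₀, hr₀, h⟩ := phi30_logCusp_nhds_openBox hopen hT hper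
  -- the slice representative of `x`
  obtain ⟨x', hx'⟩ : ∃ x' : Fin 8 → ℝ, x' = x + (-(x 0 / sParam a 0)) • sParam a := ⟨_, rfl⟩
  have hx'0 : x' 0 = 0 := by rw [hx']; simp; field_simp; ring
  have hσ' : cuspSlope a T x' = cuspSlope a T x := by rw [hx']; exact cuspSlope_add_smul_sParam hpos hT hper x _
  have hY' : 0 < shiftSize x' := by
    rcases (shiftSize_nonneg x').eq_or_lt with h0 | h0
    · exfalso
      have hz : x' = 0 := eq_zero_of_forall_phiForm_eq_zero fun k =>
        abs_nonpos_iff.mp (h0 ▸ abs_phiForm_le_shiftSize x' k)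
      rw [hz, cuspSlope_zero] at hσ'
      linarith
    · exact h0
  -- the rate `A = σ(x)/(T·Y(x')) > 0`, the threshold `L₀ = (|C|+1)/A`, the size `y`
  obtain ⟨A, hA⟩ : ∃ A : ℝ, A = cuspSlope a T x / (T * shiftSize x') := ⟨_, rfl⟩
  have hApos : 0 < A := by rw [hA]; exact div_pos hxpos (mul_pos hT hY')
  obtain ⟨L₀, hL₀⟩ : ∃ L₀ : ℝ, L₀ = (|C| + 1) / A := ⟨_, rfl⟩
  obtain ⟨y, hy⟩ : ∃ y : ℝ, y = min (min r r₀) (Real.exp (-L₀)) := ⟨_, rfl⟩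
  have hypos : 0 < y := by rw [hy]; exact lt_min (lt_min hr hr₀) (Real.exp_pos _)
  have hyr : y ≤ r := by rw [hy]; exact (min_le_left _ _).trans (min_le_left _ _)
  have hyr₀ : y ≤ r₀ := by rw [hy]; exact (min_le_left _ _).trans (min_le_right _ _)
  have hyL : y ≤ Real.exp (-L₀) := by rw [hy]; exact min_le_right _ _
  -- the displacement `η = (y/Y(x'))•x'`
  have ht : 0 < y / shiftSize x' := div_pos hypos hY'
  refine ⟨(y / shiftSize x') • x', by simp [hx'0], ?_, ?_, ?_⟩
  · rw [shiftSize_smul, abs_of_pos ht]; exact mul_pos ht hY'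
  · rw [shiftSize_smul, abs_of_pos ht, div_mul_cancel₀ _ hY'.ne']; exact hyr
  · have hYη : shiftSize ((y / shiftSize x') • x') = y := by
      rw [shiftSize_smul, abs_of_pos ht, div_mul_cancel₀ _ hY'.ne']
    have hmain := (abs_le.mp (h _ (by rw [hYη]; exact hypos) (by rw [hYη]; exact hyr₀))).1
    rw [hYη, cuspSlope_smul hpos hT hper x' ht, hσ'] at hmain
    -- `log(1/y) ≥ L₀`
    have hL : L₀ ≤ Real.log (1 / y) := by
      have h1 : Real.exp L₀ ≤ 1 / y := by
        rw [le_div_iff₀ hypos]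
        calc Real.exp L₀ * y ≤ Real.exp L₀ * Real.exp (-L₀) := mul_le_mul_of_nonneg_left hyL (Real.exp_pos _).le
          _ = 1 := by rw [← Real.exp_add, add_neg_cancel, Real.exp_zero]
      have := Real.log_le_log (Real.exp_pos _) h1
      rwa [Real.log_exp] at this
    have hAL : |C| + 1 ≤ A * Real.log (1 / y) := by
      have := mul_le_mul_of_nonneg_left hL hApos.le
      rwa [hL₀, mul_div_cancel₀ _ hApos.ne'] at this
    have e : y / shiftSize x' * cuspSlope a T x / T * Real.log (1 / y) = y * (A * Real.log (1 / y)) := by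
      rw [hA]; field_simp
    rw [e] at hmain
    have hC := le_abs_self C
    nlinarith

/-! ### Packaged with the modulus ray: the sign of `Λ` decides -/

/-- **STRICT CUSP TOP ⇒ STRICT LOCAL MAXIMUM on the slice `η₀ = 0`, inside the box, on Lemma B's coherence ball** (any
period pattern function `F`, any extension). All 28 forms of `a` positive, `a` in the closed box, `T > 0` a period. If
`cuspSlope a T δ < 0` for every non-radial `δ` (two distinct rates) — by P2 g36 `⇔ Λ(a,T) < 0` — then for some `r > 0`:
`Φ(s(a)+η) < Φ(s(a))` for every slice displacement `η₀ = 0` with `0 < Y(η) ≤ r` and `s(a)+η` in the closed box. No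
named direction is asserted to be a strict cusp top (at the cell's four named directions ascent rays exist — DATA); the
flat case `Λ = 0` is not decided; this ball is Lemma B's coherence ball, not S-E's covering ball (S-E CONJECTURED). -/
theorem phi30_lt_on_slice_of_strict {a : Dir} (ha : BZBox a) (hpos : ∀ k, 0 < h28 a k) {T : ℝ} (hT : 0 < T)
    (hper : ∀ k : Fin 28, ∃ z : ℤ, T * h28 a k = z)
    {M : ℕ → Finset (Fin 28)} {f : ℕ → Finset (Fin 28) → ℝ}
    (hf : ∀ m, m + 1 < (bkpts a T).card → ∀ Δ : Fin 8 → ℝ, (∀ k, |phiForm Δ k| < 1) →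
      (∀ k, |phiForm Δ k| < wallDist a T) →
        (torusN (bkpt a T m • sParam a + Δ) : ℝ) = f m ((M m).filter fun k => 0 ≤ phiForm Δ k))
    {F : Finset (Fin 28) → ℝ} (hF : ∀ A, F A = ∑ m ∈ Finset.range ((bkpts a T).card - 1), f m (A ∩ M m))
    (hstrict : ∀ δ : Fin 8 → ℝ, (∃ k l, phiForm δ k / h28 a k ≠ phiForm δ l / h28 a l) → cuspSlope a T δ < 0) :
    ∃ r : ℝ, 0 < r ∧ ∀ η : Fin 8 → ℝ, η 0 = 0 → 0 < shiftSize η → shiftSize η ≤ r →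
      BZBox (aOfS (sParam a + η)) → phi30 (aOfS (sParam a + η)) < phi30 a := by
  obtain ⟨x, -, -, ⟨hxne, -⟩, hmod, -⟩ := exists_modulus_ray hpos hT hper hf hF
  exact phi30_lt_on_slice_of_modulus_neg ha hpos hT hper hmod
    ((forall_cuspSlope_neg_iff_modulus_neg hxne hmod).mp hstrict)

/-- **STRICT CUSP TOP ⇒ STRICT LOCAL MAXIMUM on the slice `η₀ = 0`, inside the box, on Lemma B's coherence ball —
CANONICAL FORM** (`F = Σ_m patternN a b_m`, P2 g33; inputs: the direction in the closed box, the period, strictness;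
no named direction asserted, flat case not decided). -/
theorem phi30_lt_on_slice_of_strict_canonical {a : Dir} (ha : BZBox a) (hpos : ∀ k, 0 < h28 a k) {T : ℝ}
    (hT : 0 < T) (hper : ∀ k : Fin 28, ∃ z : ℤ, T * h28 a k = z)
    (hstrict : ∀ δ : Fin 8 → ℝ, (∃ k l, phiForm δ k / h28 a k ≠ phiForm δ l / h28 a l) → cuspSlope a T δ < 0) :
    ∃ r : ℝ, 0 < r ∧ ∀ η : Fin 8 → ℝ, η 0 = 0 → 0 < shiftSize η → shiftSize η ≤ r →
      BZBox (aOfS (sParam a + η)) → phi30 (aOfS (sParam a + η)) < phi30 a := by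
  classical
  exact phi30_lt_on_slice_of_strict ha hpos hT hper
    (M := fun m => Finset.univ.filter fun k => ∃ z : ℤ, bkpt a T m * h28 a k = z)
    (f := fun m A => ((patternN a (bkpt a T m) A : ℤ) : ℝ)) (canonical_junction_agreement a T)
    (canonical_period_eq_sum_inter (F := fun A => ∑ m ∈ Finset.range ((bkpts a T).card - 1),
      ((patternN a (bkpt a T m) A : ℤ) : ℝ)) fun _ => rfl) hstrict

/-- **THE DICHOTOMY ON THE OPEN BOX.** For `a` with `0 < s_j(a) < s₀(a)` (`j = 1..7`) and a period `T`:
(1) if `σ < 0` in every non-radial direction (`⇔ Λ < 0`), then `s(a)` is a STRICT local maximum of the MODEL saving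
on the slice `η₀ = 0`, inside the open box, on Lemma B's coherence ball — `Φ(s(a)+η) < Φ(s(a))` for all `η₀ = 0`,
`0 < Y(η) ≤ r`; (2) if `σ > 0` in SOME direction (`⇔ Λ > 0`), then inside every `Y`-ball some slice displacement has
`Φ(s(a)+η) > Φ(s(a))`. Two implications, no «iff»: the flat case `Λ = 0` is NOT decided by the first order. Which case
a given lattice direction is in is NOT asserted here (this ball is Lemma B's coherence ball, not S-E's covering ball;
S-E stays CONJECTURED). -/
theorem slice_dichotomy_openBox {a : Dir}
    (hopen : ∀ j : Fin 7, 0 < sParam a j.succ ∧ sParam a j.succ < sParam a 0)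
    {T : ℝ} (hT : 0 < T) (hper : ∀ k : Fin 28, ∃ z : ℤ, T * h28 a k = z) :
    ((∀ δ : Fin 8 → ℝ, (∃ k l, phiForm δ k / h28 a k ≠ phiForm δ l / h28 a l) → cuspSlope a T δ < 0) →
      ∃ r : ℝ, 0 < r ∧ ∀ η : Fin 8 → ℝ, η 0 = 0 → 0 < shiftSize η → shiftSize η ≤ r →
        phi30 (aOfS (sParam a + η)) < phi30 a) ∧
    ((∃ δ : Fin 8 → ℝ, 0 < cuspSlope a T δ) →
      ∀ r : ℝ, 0 < r → ∃ η : Fin 8 → ℝ, η 0 = 0 ∧ 0 < shiftSize η ∧ shiftSize η ≤ r ∧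
        phi30 a < phi30 (aOfS (sParam a + η))) := by
  have hpos := h28_pos_of_openBox hopen
  refine ⟨fun hstrict => ?_, fun ⟨δ, hδ⟩ r hr => exists_phi30_gt_on_slice_of_cuspSlope_pos hopen hT hper hδ hr⟩
  obtain ⟨r, hr, h⟩ := phi30_lt_on_slice_of_strict_canonical (BZBox_of_openBox hopen) hpos hT hper hstrict
  obtain ⟨r₁, hr₁, hbox⟩ := BZBox_perturb_of_shiftSize_le hopen
  exact ⟨min r r₁, lt_min hr hr₁, fun η h0 hY hYr =>
    h η h0 hY (hYr.trans (min_le_left _ _)) (hbox η (hYr.trans (min_le_right _ _)))⟩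

/-! ### The same in topological vocabulary -/

/-- **STRICT CUSP TOP ⇒ `IsLocalMaxOn`** on the slice `η₀ = 0`, inside the open box, from Lemma B's coherence ball
(Mathlib's vocabulary): if `σ < 0` in every non-radial direction, then `η ↦ Φ(aOfS(s(a)+η))` has a local maximum at `0`
on the hyperplane `{η | η₀ = 0}` — in the coordinates `t = s/s₀` of `BARRIER-PLAN.md` §2b: `t ↦ Φ(1, t)` has a local
maximum at `t(a)` (indeed a strict one, `slice_dichotomy_openBox`). One implication; the flat case `Λ = 0` is NOT
decided and no iff is claimed. No named direction is asserted to satisfy the hypothesis. -/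
theorem isLocalMaxOn_slice_of_strict {a : Dir}
    (hopen : ∀ j : Fin 7, 0 < sParam a j.succ ∧ sParam a j.succ < sParam a 0)
    {T : ℝ} (hT : 0 < T) (hper : ∀ k : Fin 28, ∃ z : ℤ, T * h28 a k = z)
    (hstrict : ∀ δ : Fin 8 → ℝ, (∃ k l, phiForm δ k / h28 a k ≠ phiForm δ l / h28 a l) → cuspSlope a T δ < 0) :
    IsLocalMaxOn (fun η : Fin 8 → ℝ => phi30 (aOfS (sParam a + η))) {η | η 0 = 0} 0 := by
  have hpos := h28_pos_of_openBox hopen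
  obtain ⟨r, hr, h⟩ := (slice_dichotomy_openBox hopen hT hper).1 hstrict
  have hball : Metric.ball (0 : Fin 8 → ℝ) (r / 2) ∈ 𝓝[{η | η 0 = 0}] (0 : Fin 8 → ℝ) :=
    mem_nhdsWithin_of_mem_nhds (Metric.ball_mem_nhds 0 (by linarith))
  refine Filter.mem_of_superset (Filter.inter_mem hball self_mem_nhdsWithin) ?_
  rintro η ⟨hηball, hη0⟩
  simp only [Set.mem_setOf_eq] at hη0 ⊢
  rw [add_zero, aOfS_sParam]
  have hnorm : ‖η‖ < r / 2 := by simpa using hηball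
  have hYr : shiftSize η ≤ r := by linarith [shiftSize_le_two_mul_norm η]
  rcases (shiftSize_nonneg η).eq_or_lt with hY | hY
  · -- `Y(η) = 0`: all forms vanish, `η = 0`
    have hz : η = 0 := eq_zero_of_forall_phiForm_eq_zero fun k =>
      abs_nonpos_iff.mp (hY ▸ abs_phiForm_le_shiftSize η k)
    rw [hz, add_zero, aOfS_sParam]
  · exact (h η hη0 hY hYr).le

/-- **AN ASCENT DIRECTION ⇒ NOT `IsLocalMaxOn`** on the slice `η₀ = 0`, inside the open box, on any ball (in particular
on Lemma B's coherence ball): if `cuspSlope a T δ > 0` for some `δ`, then `η ↦ Φ(aOfS(s(a)+η))` has NO local maximum at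
`0` on `{η | η₀ = 0}`. One implication; the flat case `Λ = 0` is NOT decided and no iff is claimed. -/
theorem not_isLocalMaxOn_slice_of_ascent {a : Dir}
    (hopen : ∀ j : Fin 7, 0 < sParam a j.succ ∧ sParam a j.succ < sParam a 0)
    {T : ℝ} (hT : 0 < T) (hper : ∀ k : Fin 28, ∃ z : ℤ, T * h28 a k = z) {δ : Fin 8 → ℝ}
    (hδ : 0 < cuspSlope a T δ) :
    ¬ IsLocalMaxOn (fun η : Fin 8 → ℝ => phi30 (aOfS (sParam a + η))) {η | η 0 = 0} 0 := by
  intro hmax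
  have hmax' : ∀ᶠ η in 𝓝[{η | η 0 = 0}] (0 : Fin 8 → ℝ), phi30 (aOfS (sParam a + η)) ≤ phi30 a := by
    have := hmax
    simp only [IsLocalMaxOn, IsMaxFilter, add_zero, aOfS_sParam] at this
    exact this
  obtain ⟨U, hU, hUsub⟩ := mem_nhdsWithin_iff_exists_mem_nhds_inter.mp hmax'
  obtain ⟨ρ, hρ, hball⟩ := Metric.mem_nhds_iff.mp hU
  obtain ⟨η, hη0, -, hYr, hgt⟩ :=
    exists_phi30_gt_on_slice_of_cuspSlope_pos hopen hT hper hδ (show 0 < ρ / 5 by linarith)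
  have hηU : η ∈ U := hball (by
    rw [Metric.mem_ball, dist_zero_right]
    linarith [norm_le_shiftSize η])
  have := hUsub ⟨hηU, hη0⟩
  simp only [Set.mem_setOf_eq] at this
  linarith

end Summit.KontsevichZagierPeriods.Zeta5Search.Barrier.ConeGamma

end
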